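import Mathlib
import HarnessLib
import Literature.MathematicalPhysics.QuantumLattice.HubbardEffectiveActionCTSpinRotation
import Summits.HubbardSuperconductivity.HubbardSuperconductivity.Theorems.KLProgrammeKLRegimeSplitValueIdentification

/-!
# Route `KLProgramme` — crux K3, ENGINE child (`KLRegimeEngineV7`, stmt-HubbardSuperconductivity-19662): the QUARTIC SPIN WARD
# IDENTITY of the countertermed effective action — equal-spin kernels from the `↑↓` ones

Cell gate-hubbard-kl, seat p3 (g4).  The engine slot states its value clauses at the single spin pattern `(↑,↓) = (0,1)`
(`…SplitSpin01`/`…LegStaging`: `QuarticValueIncrementAtS2`, `QuarticValueUVAtS`, `IsoTupleL1AtS`), on the understanding that "the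
engine derives the other spin patterns by `SU(2)` and spin flip inside child 3" (Δ-spin; kl-ref rider R4).  This file supplies
that derivation for the quartic kernels of `𝒢^K_Λ = hubbardEffectiveActionCT L M β U μ 0 K Λ` (any frame, any scale; seed `h = 0`):
from the spin-rotation Ward identity (`kernel_hubbardEffectiveActionCT_spinRot`, `Literature/…/HubbardEffectiveActionCTSpinRotation.lean`,
at the rational rotation `R = (3/5, −4/5; 4/5, 3/5)`), the spin-resolved `U(1)` selection rule
(`kernel_hubbardEffectiveActionCT_eq_zero_of_spinCharge`, `…SpinCharge.lean`) and the spin flip (`kernel_hubbardEffectiveActionCT_spinFlip`,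
`…SpinFlip.lean`):
* **`kernel_hubbardEffectiveActionCT_quartic_spinWard`** — for legs `(ψ̂⁺_{K₁}, ψ̂⁻_{K₂}, ψ̂⁺_{K₃}, ψ̂⁻_{K₄})`,
  `F₄(↑↑↑↑)(K₁,K₂,K₃,K₄) = F₄(↑↑↓↓)(K₁,K₂,K₃,K₄) − F₄(↑↑↓↓)(K₃,K₂,K₁,K₄)` (BGM 2006 (2.25): the equal-spin amplitude is the
  antisymmetrised opposite-spin one);
* **`klQuarticValue_equalSpin`** — the same for the engine's running-coupling values: `λ_n^{σσ}(k₁,k₂,k₃) = λ_n^{↑↓}(k₁,k₂,k₃) −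
  (exchanged-leg vertex function at frequencies (−ω₀, ω₀, ω₀, −ω₀))`.
Everything is proved; no definitions.
-/

noncomputable section

namespace Summit.HubbardSuperconductivity.HubbardSuperconductivity.Theorems.KLRegimeSplit

set_option linter.dupNamespace false -- summit = problem name (single-conjunct summit), D-0017

open Literature.MathematicalPhysics.QuantumLattice Literature.Probability.LatticeModels Finset
open Summit.HubbardSuperconductivity.HubbardSuperconductivity.Theorems.KLProgrammeLegKernels

/-- A sum over spin assignments of four legs, unrolled: `Σ_{τ : Fin 4 → α} F τ = Σ_a Σ_b Σ_c Σ_d F ![a, b, c, d]`. -/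
theorem sum_pi_fin_four {α : Type*} [Fintype α] {N : Type*} [AddCommMonoid N] (F : (Fin 4 → α) → N) :
    ∑ τ, F τ = ∑ a, ∑ b, ∑ c, ∑ d, F ![a, b, c, d] := by
  rw [← Fintype.sum_equiv (⟨fun p => ![p.1, p.2.1, p.2.2.1, p.2.2.2], fun τ => (τ 0, τ 1, τ 2, τ 3), fun p => rfl,
      fun τ => by funext i; fin_cases i <;> rfl⟩ : α × α × α × α ≃ (Fin 4 → α))
    (fun p => F ![p.1, p.2.1, p.2.2.1, p.2.2.2]) F (fun p => rfl)]
  simp only [Fintype.sum_prod_type]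

section Model

variable (L M : ℕ) [NeZero L]

set_option maxHeartbeats 400000 in
/-- **The quartic spin Ward identity of the countertermed effective action** (BGM 2006 §2.1 symmetries (1)–(3), §2.3 / (2.25)): for
every frame `K`, scale `Λ`, and frequency–momenta `K₁, K₂, K₃, K₄` of the legs `(ψ̂⁺, ψ̂⁻, ψ̂⁺, ψ̂⁻)`,
`F₄(↑,↑,↑,↑) = F₄(↑,↑,↓,↓) − F₄(↑,↑,↓,↓)∘(K₁ ↔ K₃)` — the equal-spin quartic kernel is the antisymmetrisation in the two `ψ̂⁺` legs of
the opposite-spin one. -/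
theorem kernel_hubbardEffectiveActionCT_quartic_spinWard (β U μ : ℝ) (K : TrigPolyC4v) (Λ : ℝ) (K₁ K₂ K₃ K₄ : FreqMomentum L M) :
    kernel ℂ (hubbardEffectiveActionCT L M β U μ 0 K Λ) 4 ![((K₁, 0), 0), ((K₂, 0), 1), ((K₃, 0), 0), ((K₄, 0), 1)] =
      kernel ℂ (hubbardEffectiveActionCT L M β U μ 0 K Λ) 4 ![((K₁, 0), 0), ((K₂, 0), 1), ((K₃, 1), 0), ((K₄, 1), 1)] -
        kernel ℂ (hubbardEffectiveActionCT L M β U μ 0 K Λ) 4 ![((K₃, 0), 0), ((K₂, 0), 1), ((K₁, 1), 0), ((K₄, 1), 1)] := by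
  set G := hubbardEffectiveActionCT L M β U μ 0 K Λ with hG
  -- spin patterns on the fixed legs
  set pat : (Fin 4 → Fin 2) → Fin 4 → HubbardFieldIdx L M :=
    fun τ i => ((![K₁, K₂, K₃, K₄] i, τ i), ![(0 : Fin 2), 1, 0, 1] i) with hpat
  have hP : ∀ a b c d : Fin 2, pat ![a, b, c, d] = ![((K₁, a), 0), ((K₂, b), 1), ((K₃, c), 0), ((K₄, d), 1)] := by
    intro a b c d; funext i; fin_cases i <;> rfl
  -- the rational rotation
  set R : Matrix (Fin 2) (Fin 2) ℂ := !![3 / 5, -(4 / 5); 4 / 5, 3 / 5] with hR_def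
  have hR : R.transpose * R = 1 := by
    ext i j
    fin_cases i <;> fin_cases j <;> simp [hR_def, Matrix.mul_apply, Fin.sum_univ_two] <;> norm_num
  -- the raw Ward identity at the external pattern `(↑,↑,↑,↓)`, whose kernel vanishes by the selection rule
  have hraw : kernel ℂ G 4 (pat ![0, 0, 0, 1]) = ∑ τ : Fin 4 → Fin 2, (∏ i, R (![(0 : Fin 2), 0, 0, 1] i) (τ i)) * kernel ℂ G 4 (pat τ) :=
    kernel_hubbardEffectiveActionCT_spinRot L M R hR β U μ K Λ (pat ![0, 0, 0, 1])
  have hsel : ∀ τ : Fin 4 → Fin 2,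
      (Finset.univ.filter fun i => (pat τ i).1.2 = 0 ∧ (pat τ i).2 = 0).card ≠
        (Finset.univ.filter fun i => (pat τ i).1.2 = 0 ∧ (pat τ i).2 = 1).card → kernel ℂ G 4 (pat τ) = 0 :=
    fun τ hne => kernel_hubbardEffectiveActionCT_eq_zero_of_spinCharge L M β U μ K Λ (pat τ) 0 hne
  have z0001 : kernel ℂ G 4 (pat ![0, 0, 0, 1]) = 0 := hsel _ (by
    simp only [hpat, Finset.card_filter, Fin.sum_univ_four, Fin.isValue, Matrix.cons_val_zero, Matrix.cons_val_one,
      Matrix.head_cons, Matrix.cons_val_two, Matrix.cons_val_three, Matrix.tail_cons]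
    decide)
  have z0010 : kernel ℂ G 4 (pat ![0, 0, 1, 0]) = 0 := hsel _ (by
    simp only [hpat, Finset.card_filter, Fin.sum_univ_four, Fin.isValue, Matrix.cons_val_zero, Matrix.cons_val_one,
      Matrix.head_cons, Matrix.cons_val_two, Matrix.cons_val_three, Matrix.tail_cons]
    decide)
  have z0100 : kernel ℂ G 4 (pat ![0, 1, 0, 0]) = 0 := hsel _ (by
    simp only [hpat, Finset.card_filter, Fin.sum_univ_four, Fin.isValue, Matrix.cons_val_zero, Matrix.cons_val_one,
      Matrix.head_cons, Matrix.cons_val_two, Matrix.cons_val_three, Matrix.tail_cons]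
    decide)
  have z1000 : kernel ℂ G 4 (pat ![1, 0, 0, 0]) = 0 := hsel _ (by
    simp only [hpat, Finset.card_filter, Fin.sum_univ_four, Fin.isValue, Matrix.cons_val_zero, Matrix.cons_val_one,
      Matrix.head_cons, Matrix.cons_val_two, Matrix.cons_val_three, Matrix.tail_cons]
    decide)
  have z0111 : kernel ℂ G 4 (pat ![0, 1, 1, 1]) = 0 := hsel _ (by
    simp only [hpat, Finset.card_filter, Fin.sum_univ_four, Fin.isValue, Matrix.cons_val_zero, Matrix.cons_val_one,
      Matrix.head_cons, Matrix.cons_val_two, Matrix.cons_val_three, Matrix.tail_cons]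
    decide)
  have z1011 : kernel ℂ G 4 (pat ![1, 0, 1, 1]) = 0 := hsel _ (by
    simp only [hpat, Finset.card_filter, Fin.sum_univ_four, Fin.isValue, Matrix.cons_val_zero, Matrix.cons_val_one,
      Matrix.head_cons, Matrix.cons_val_two, Matrix.cons_val_three, Matrix.tail_cons]
    decide)
  have z1101 : kernel ℂ G 4 (pat ![1, 1, 0, 1]) = 0 := hsel _ (by
    simp only [hpat, Finset.card_filter, Fin.sum_univ_four, Fin.isValue, Matrix.cons_val_zero, Matrix.cons_val_one,
      Matrix.head_cons, Matrix.cons_val_two, Matrix.cons_val_three, Matrix.tail_cons]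
    decide)
  have z1110 : kernel ℂ G 4 (pat ![1, 1, 1, 0]) = 0 := hsel _ (by
    simp only [hpat, Finset.card_filter, Fin.sum_univ_four, Fin.isValue, Matrix.cons_val_zero, Matrix.cons_val_one,
      Matrix.head_cons, Matrix.cons_val_two, Matrix.cons_val_three, Matrix.tail_cons]
    decide)
  have z0101 : kernel ℂ G 4 (pat ![0, 1, 0, 1]) = 0 := hsel _ (by
    simp only [hpat, Finset.card_filter, Fin.sum_univ_four, Fin.isValue, Matrix.cons_val_zero, Matrix.cons_val_one,
      Matrix.head_cons, Matrix.cons_val_two, Matrix.cons_val_three, Matrix.tail_cons]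
    decide)
  have z1010 : kernel ℂ G 4 (pat ![1, 0, 1, 0]) = 0 := hsel _ (by
    simp only [hpat, Finset.card_filter, Fin.sum_univ_four, Fin.isValue, Matrix.cons_val_zero, Matrix.cons_val_one,
      Matrix.head_cons, Matrix.cons_val_two, Matrix.cons_val_three, Matrix.tail_cons]
    decide)
  -- spin flips
  have hflip : ∀ τ : Fin 4 → Fin 2, kernel ℂ G 4 (pat (fun i => Equiv.swap (0 : Fin 2) 1 (τ i))) = kernel ℂ G 4 (pat τ) :=
    fun τ => kernel_hubbardEffectiveActionCT_spinFlip L M β U μ K Λ 4 (pat τ)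
  have f1111 : kernel ℂ G 4 (pat ![1, 1, 1, 1]) = kernel ℂ G 4 (pat ![0, 0, 0, 0]) := by
    rw [← hflip]; congr 1; funext i; fin_cases i <;> rfl
  have f1100 : kernel ℂ G 4 (pat ![1, 1, 0, 0]) = kernel ℂ G 4 (pat ![0, 0, 1, 1]) := by
    rw [← hflip]; congr 1; funext i; fin_cases i <;> rfl
  have f0110 : kernel ℂ G 4 (pat ![0, 1, 1, 0]) = kernel ℂ G 4 (pat ![1, 0, 0, 1]) := by
    rw [← hflip]; congr 1; funext i; fin_cases i <;> rfl
  -- the exchange term: legs 0 ↔ 2 (a transposition, sign −1)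
  have hexch : kernel ℂ G 4 (pat ![1, 0, 0, 1]) =
      -kernel ℂ G 4 ![((K₃, 0), 0), ((K₂, 0), 1), ((K₁, 1), 0), ((K₄, 1), 1)] := by
    have h := klka_kernel_comp_perm ℂ G ![((K₃, 0), 0), ((K₂, 0), 1), ((K₁, 1), 0), ((K₄, 1), 1)] (Equiv.swap (0 : Fin 4) 2)
    have hX : (![((K₃, 0), 0), ((K₂, 0), 1), ((K₁, 1), 0), ((K₄, 1), 1)] : Fin 4 → HubbardFieldIdx L M) ∘ (Equiv.swap (0 : Fin 4) 2) =
        pat ![1, 0, 0, 1] := by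
      funext i; fin_cases i <;> rfl
    rw [hX, Equiv.Perm.sign_swap (by decide)] at h
    rw [h]; simp
  -- unroll the Ward identity and conclude
  rw [z0001, sum_pi_fin_four] at hraw
  simp only [Fin.sum_univ_two, Fin.prod_univ_four, Fin.isValue, Matrix.cons_val_zero, Matrix.cons_val_one, Matrix.head_cons,
    Matrix.cons_val_two, Matrix.cons_val_three, Matrix.tail_cons, z0001, z0010, z0100, z1000, z0111, z1011, z1101, z1110, z0101,
    z1010, f1111, f1100, f0110, mul_zero, add_zero, zero_add] at hraw
  simp only [hR_def, Matrix.of_apply, Matrix.cons_val', Matrix.cons_val_zero, Matrix.cons_val_one, Matrix.empty_val',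
    Matrix.cons_val_fin_one] at hraw
  rw [← hP 0 0 0 0, ← hP 0 0 1 1,
    show kernel ℂ G 4 ![((K₃, 0), 0), ((K₂, 0), 1), ((K₁, 1), 0), ((K₄, 1), 1)] = -kernel ℂ G 4 (pat ![1, 0, 0, 1]) by
      rw [hexch, neg_neg]]
  linear_combination ((625 : ℂ) / 84) * hraw

/-- **Equal-spin running-coupling values from the `↑↓` ones**: for the engine's `klQuarticValue` (legs
`(ω₀,k₁)σ⁺, (ω₀,k₂)σ⁻, (−ω₀,k₃)σ'⁺, (−ω₀,k₁−k₂+k₃)σ'⁻`),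
`λ_n^{↑↑}(k₁,k₂,k₃) = λ_n^{↑↓}(k₁,k₂,k₃) − 𝒱₄((−ω₀,k₃)↑⁺, (ω₀,k₂)↑⁻, (ω₀,k₁)↓⁺, (−ω₀,k₁−k₂+k₃)↓⁻)` — the exchange term lives at the
frequency pattern `(−ω₀, ω₀, ω₀, −ω₀)` (p1b's remark on Δ-spin), here written as the vertex function itself. -/
theorem klQuarticValue_equalSpin [NeZero M] (β U μ : ℝ) (K : TrigPolyC4v) (e₀ : ℝ) (n : ℕ) (k₁ k₂ k₃ : TorusSite 2 L) :
    vertexFn L M β (klEffectiveAction L M β U μ K e₀ n) 4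
        ![(((omega0 M, k₁), 0), 0), (((omega0 M, k₂), 0), 1), ((((omega0 M).rev, k₃), 0), 0),
          ((((omega0 M).rev, k₁ - k₂ + k₃), 0), 1)] =
      vertexFn L M β (klEffectiveAction L M β U μ K e₀ n) 4
          ![(((omega0 M, k₁), 0), 0), (((omega0 M, k₂), 0), 1), ((((omega0 M).rev, k₃), 1), 0),
            ((((omega0 M).rev, k₁ - k₂ + k₃), 1), 1)] -
        vertexFn L M β (klEffectiveAction L M β U μ K e₀ n) 4
          ![((((omega0 M).rev, k₃), 0), 0), (((omega0 M, k₂), 0), 1), (((omega0 M, k₁), 1), 0),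
            ((((omega0 M).rev, k₁ - k₂ + k₃), 1), 1)] := by
  simp only [vertexFn, klEffectiveAction]
  rw [kernel_hubbardEffectiveActionCT_quartic_spinWard L M β U μ K (klScale e₀ n) (omega0 M, k₁) (omega0 M, k₂)
    ((omega0 M).rev, k₃) ((omega0 M).rev, k₁ - k₂ + k₃)]
  ring

end Model

end Summit.HubbardSuperconductivity.HubbardSuperconductivity.Theorems.KLRegimeSplit

end
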